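import Summits.ResolutionOfSingularities.ResolutionOfSingularities.Theorems.EquisingularLiftEquisingularLiftNatEmbeddedLiftTorsorAction
import HarnessLib

/-!
# [OURS · L1 W4.5(b) · EL♮(3) · (T-k) · J1b complement] TRANSITIVITY of the action: every lift with difference class `φ` IS `act I' φ`
# (Hartshorne 2010 Thm. 6.2 (a): the set of lifts is a pseudotorsor — free AND transitive)

Crux chain w45b (cell `res-hironaka`, slot W4.5(b)), crux **EL♮(3)** = stmt-ResolutionOfSingularities-20148; NEED-FACT J1 = `EmbeddedInfinitesimalLiftFact`
(p596985). res-type-027 g16, complement to J1b-α (p599860) / J1b-β (p600361): the uniqueness half the patching engine (J1c (π), design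
`Lines/J1c-DESIGN-res-type-027.md`) uses — «two lifts with the same class coincide». HONEST FRAMING: OURS; NOT a statement of H. Hironaka's 2017
manuscript; AI-written, gate-checked, weaker than expert review. No `sorry`; standard axioms; DEF-FREE. `--supports stmt-ResolutionOfSingularities-20148 --as helper`.
* `act_le_of_forall_sub_mem` — if the lift `I''` realises the class `φ` on representatives (`x' − εy ∈ I'' ⇒ [y] = φ x'`), then `act I' φ ≤ I''`
  (`ε² = 0`, `εI' ⊆ I''`);
* `act_eq_of_forall_sub_mem` — … and if `A'/I''` is flat with the same reduction, `act I' φ = I''` (`eq_of_le_of_flat`, 𝔪 nilpotent): TRANSITIVITY.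
References (method / index only): R. Hartshorne, *Deformation Theory* (2010), Thm. 6.2 (a), proof p. 47.
-/

set_option linter.dupNamespace false

noncomputable section

open IsLocalRing

namespace Summit.ResolutionOfSingularities.ResolutionOfSingularities.Cruxes.EquisingularLiftNat.Sections

universe u v

variable {C' : Type u} [CommRing C'] {𝔪 : Ideal C'} (ε : C') {A' : Type v} [CommRing A'] [Algebra C' A']

/-- `εI' ⊆ I''` for lifts agreeing modulo `ε` (`ε² = 0`). [folklore] -/
theorem mul_mem_of_mem_of_le_sup_span (hann : ∀ c : C', ε * c = 0 ↔ c ∈ 𝔪) (hεm : ε ∈ 𝔪) (I' I'' : Ideal A')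
    (hI : I' ≤ I'' ⊔ Ideal.span {algebraMap C' A' ε}) {i : A'} (hi : i ∈ I') : algebraMap C' A' ε * i ∈ I'' := by
  obtain ⟨j, hj, e, he, rfl⟩ := Submodule.mem_sup.mp (hI hi)
  obtain ⟨s, rfl⟩ := Ideal.mem_span_singleton'.mp he
  have hε2 : algebraMap C' A' ε * algebraMap C' A' ε = 0 := by rw [← map_mul, (hann ε).mpr hεm, map_zero]
  rw [mul_add, show algebraMap C' A' ε * (s * algebraMap C' A' ε) = s * (algebraMap C' A' ε * algebraMap C' A' ε) by ring, hε2, mul_zero, add_zero]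
  exact I''.mul_mem_left _ hj

/-- **`act I' φ ≤ I''` when `I''` realises `φ`**: if every `x' − εy ∈ I''` (`x' ∈ I'`) has `[y] = φ(x')` in `A'/(I' + 𝔪A')`, and the lifts agree modulo
`ε`, then Hartshorne's `I''`-from-`φ` is contained in `I''`. [cite: Hartshorne2010, Thm. 6.2 (a)] -/
theorem act_le_of_forall_sub_mem (hann : ∀ c : C', ε * c = 0 ↔ c ∈ 𝔪) (hεm : ε ∈ 𝔪) (I' I'' : Ideal A')
    (φ : I' →ₗ[A'] A' ⧸ (I' ⊔ 𝔪.map (algebraMap C' A')))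
    (hI : I' ≤ I'' ⊔ Ideal.span {algebraMap C' A' ε})
    (h : ∀ (x : I') (y : A'), (x : A') - algebraMap C' A' ε * y ∈ I'' → Ideal.Quotient.mk (I' ⊔ 𝔪.map (algebraMap C' A')) y = φ x) :
    act ε I' φ ≤ I'' := by
  intro z hz
  obtain ⟨x, t, ht, rfl⟩ := (mem_act_iff ε I' φ).mp hz
  obtain ⟨y, hy⟩ := exists_sub_mul_mem I' I'' hI x
  have hyt : y - t ∈ I' ⊔ 𝔪.map (algebraMap C' A') := by
    rw [← Ideal.Quotient.eq, h x y hy, ht]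
  obtain ⟨i, hi, m, hm, him⟩ := Submodule.mem_sup.mp hyt
  -- `x - εt = (x - εy) + ε(y - t) = (x - εy) + εi + εm`, `εi ∈ I''`, `εm = 0`
  have hεyt : algebraMap C' A' ε * (y - t) ∈ I'' := by
    rw [← him, mul_add, algebraMap_mul_eq_zero_of_mem_map hann hm, add_zero]
    exact mul_mem_of_mem_of_le_sup_span ε hann hεm I' I'' hI hi
  have : (x : A') - algebraMap C' A' ε * t = ((x : A') - algebraMap C' A' ε * y) + algebraMap C' A' ε * (y - t) := by ring
  rw [this]
  exact I''.add_mem hy hεyt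

/-- **Transitivity**: a lift `I''` with flat quotient, agreeing with `I'` modulo `ε` and realising the class `φ`, EQUALS `act I' φ` (`𝔪` nilpotent).
With J1b-β's `liftDiff_act` and J1b-α's `liftDiff_eq_zero_iff_eq` this completes «the set of lifts is a pseudotorsor» in both directions.
[cite: Hartshorne2010, Thm. 6.2 (a)] -/
theorem act_eq_of_forall_sub_mem (hann : ∀ c : C', ε * c = 0 ↔ c ∈ 𝔪) (hεm : ε ∈ 𝔪) (hnil : IsNilpotent 𝔪) (I' I'' : Ideal A')
    [Module.Flat C' (A' ⧸ I'')] (φ : I' →ₗ[A'] A' ⧸ (I' ⊔ 𝔪.map (algebraMap C' A')))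
    (hI : I' ≤ I'' ⊔ Ideal.span {algebraMap C' A' ε}) (hI' : I'' ≤ I' ⊔ Ideal.span {algebraMap C' A' ε})
    (h : ∀ (x : I') (y : A'), (x : A') - algebraMap C' A' ε * y ∈ I'' → Ideal.Quotient.mk (I' ⊔ 𝔪.map (algebraMap C' A')) y = φ x) :
    act ε I' φ = I'' :=
  eq_of_le_of_flat hann hεm hnil (act ε I' φ) I'' (act_le_of_forall_sub_mem ε hann hεm I' I'' φ hI h)
    (hI'.trans (by rw [act_sup_span_eq ε I' φ]))

end Summit.ResolutionOfSingularities.ResolutionOfSingularities.Cruxes.EquisingularLiftNat.Sections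

end
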